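import Literature.MathematicalPhysics.QuantumChemistry.GroupLocalFormBound
import Literature.MathematicalPhysics.QuantumChemistry.LevelShiftDeflation
import HarnessLib

/-!
# Tensor-block spectrum lemma with inter-group density–density terms

Topic `Literature/MathematicalPhysics/QuantumChemistry`. HONEST FRAMING: certified bounds for a stated
model Hamiltonian in a stated basis; not a claim about the real molecule or material beyond that model —
finite-dimensional linear algebra on the tree's second-quantised Fock space; certifies no number. WHAT
THIS FILE IS NOT: not a statement about any semidefinite programme, not a bound on any pinned file.

Extension of `GroupLocalFormBound.lean` (`groupLocal_form_le`, group-LOCAL tables: `h_pq ≠ 0 ⇒ p ~ q`,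
`(pq|rs) ≠ 0 ⇒ p ~ q ~ r ~ s`). A deflator made of a sub-Hamiltonian of one group plus a POLYNOMIAL in
the particle numbers of other groups (cell chem-oracle, door M1-OS, chem-idea-2 DESIGN-M1OS (0.1):
`X = P(ĥ, v̂) − κ·Ĥ_MAG^fc`, `P` quadratic with a cross term `f·ĥ·v̂`) is NOT group-local: the cross
term is a two-electron entry `(pp|rr)` with `p`, `r` in DIFFERENT groups. §1: an INTER-GROUP
DENSITY–DENSITY table `(pp|rr) = b×(grp p, grp r)` (`r ≁ p`) generates `½ Σ_{i≠j} b×(i,j) N̂_i N̂_j`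
(`e_pprr = E_pp E_rr` for `p ≠ r`, Helgaker–Jørgensen–Olsen eqs. (2.2.7), (2.2.16)), DIAGONAL with value
`½ Σ_{i≠j} b×(i,j) l_i l_j` on the joint occupation class `l` (`molecularHamiltonian_crossDensity_eq_diagonal`,
`crossDensity_mulVec_of_occupation`); hence `groupLocalCross_form_le`: if every non-zero two-electron
entry is EITHER group-local OR a diagonal density pair `(pp|rr)`, and the inter-group ones are the
group-pair constants `b×`, then on the class `l`,
`Re⟨z, Ĥ(h, g, c) z⟩ ≤ (Re c + Σ_i U_i(l_i) + Re(½ Σ_{i≠j} b×(i,j) l_i l_j))·‖z‖²` with the local tops `U_i`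
of the group restrictions as before (they do not see the inter-group entries). §2: a group whose OWN
tables are a uniform number polynomial (`h_pq = α[p=q]`, `(pq|rs) = β[q=p][s=r]`) has the EXACT local
top `c + αN + ½β(N² − N)` on its `N`-particle sectors (`uniformDensity_form_eq`) — the kernel discharge
of `hU` for such groups. Everything is PROVED (0 sorry, no new definition); in-house linear algebra,
the cited places are the provenance of the MECHANISM, not restated facts.

## References
* T. Helgaker, P. Jørgensen, J. Olsen, *Molecular Electronic-Structure Theory* (2000), eqs. (2.2.7),
  (2.2.16), (2.2.18). [HelgakerJorgensenOlsen2000]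
* B. Verstichel, H. van Aggelen, D. Van Neck, P. W. Ayers, P. Bultinck, J. Chem. Phys. 132 (2010)
  114113, arXiv:0910.4094, §2.3 eq. (16) (determinants classified by the number of subsystem
  orbitals). [VerstichelEtAl2010Subsystem]
-/

noncomputable section

namespace Literature.MathematicalPhysics.QuantumChemistry

open Matrix Finset Literature.MathematicalPhysics.QuantumLattice
open scoped ComplexOrder BigOperators

section CrossDensity

variable {Λ' : Type*} [LinearOrder Λ'] [Fintype Λ']
variable {X : Type*} [Fintype X] [DecidableEq X]

/-- `E_pp` (Helgaker–Jørgensen–Olsen eq. (2.2.7) at `p = q`) is DIAGONAL on determinants with value the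
spatial occupation `n_p(s) = [p ∈ s↑] + [p ∈ s↓]`. [cite: HelgakerJorgensenOlsen2000, eq. (2.2.7)] -/
theorem singletExcitation_self_eq_diagonal (p : Λ') :
    singletExcitation p p = diagonal fun s : Finset (Orb Λ') =>
      ((((if p ∈ upPart s then (1 : ℝ) else 0) + (if p ∈ downPart s then (1 : ℝ) else 0) : ℝ)) : ℂ) := by
  classical
  have h := weightedNumber_eq_diagonal (Λ := Λ') (fun q => if q = p then (1 : ℝ) else 0)
  simp only [apply_ite Complex.ofReal, Complex.ofReal_one, Complex.ofReal_zero, ite_smul, one_smul,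
    zero_smul, Finset.sum_ite_eq', Finset.mem_univ, if_true] at h
  rw [h]

/-- **Additivity in the two-electron table**: `Ĥ(h, g₁ + g₂, c) = Ĥ(h, g₁, c) + Ĥ(0, g₂, 0)`
(eq. (2.2.18) is linear in the tables). [cite: HelgakerJorgensenOlsen2000, eq. (2.2.18)] -/
theorem molecularHamiltonian_add_eri (h : Λ' → Λ' → ℂ) (g₁ g₂ : Λ' → Λ' → Λ' → Λ' → ℂ) (c : ℂ) :
    molecularHamiltonian h (fun p q r s => g₁ p q r s + g₂ p q r s) c =
      molecularHamiltonian h g₁ c + molecularHamiltonian (fun _ _ => (0 : ℂ)) g₂ 0 := by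
  unfold molecularHamiltonian
  simp only [add_smul, Finset.sum_add_distrib, smul_add, zero_smul, Finset.sum_const_zero, zero_add,
    add_zero]
  abel

omit [Fintype X] in
/-- The group-`i` sum of the orbital occupations of a determinant is its group occupation
`|s↑ ∩ group i| + |s↓ ∩ group i|` ("the number of subsystem orbitals" of a determinant, Verstichel et
al. (2010) eq. (16); bookkeeping). [cite: VerstichelEtAl2010Subsystem, §2.3 eq. (16)] -/
theorem sum_filter_orbital_occupation (grp : Λ' → X) (i : X) (s : Finset (Orb Λ')) :
    (∑ p ∈ Finset.univ.filter (fun p => grp p = i),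
        ((((if p ∈ upPart s then (1 : ℝ) else 0) + (if p ∈ downPart s then (1 : ℝ) else 0) : ℝ)) : ℂ)) =
      ((((upPart s).filter (fun p => grp p = i)).card +
        ((downPart s).filter (fun p => grp p = i)).card : ℕ) : ℂ) := by
  classical
  have e : ∀ T : Finset Λ', Finset.univ.filter (fun p => grp p = i) ∩ T = T.filter (fun p => grp p = i) :=
    fun T => by ext p; simp only [Finset.mem_inter, Finset.mem_filter, Finset.mem_univ, true_and, and_comm]
  simp only [Complex.ofReal_add, apply_ite Complex.ofReal, Complex.ofReal_one, Complex.ofReal_zero,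
    Finset.sum_add_distrib]
  rw [Finset.sum_ite_mem, Finset.sum_ite_mem, e, e, Finset.sum_const, Finset.sum_const,
    nsmul_eq_mul, nsmul_eq_mul, mul_one, mul_one, Nat.cast_add]

omit [LinearOrder Λ'] in
/-- Exchange of the orbital double sum with the group double sum for group-pair coefficients on pairs
in DIFFERENT groups: `Σ_{p,r: r≁p} b×(grp p, grp r) n_p n_r = Σ_{i≠j} b×(i,j) (Σ_{p∈i} n_p)(Σ_{r∈j} n_r)`
(bookkeeping, orbitals classified by group). [cite: VerstichelEtAl2010Subsystem, §2.3 eq. (16)] -/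
theorem sum_sum_cross_eq_sum_sum_groups (grp : Λ' → X) (bx : X → X → ℂ) (n : Λ' → ℂ) :
    (∑ p, ∑ r, (if grp r ≠ grp p then bx (grp p) (grp r) else 0) * (n p * n r)) =
      ∑ i, ∑ j, if i ≠ j then bx i j * ((∑ p ∈ Finset.univ.filter (fun p => grp p = i), n p) *
        (∑ r ∈ Finset.univ.filter (fun r => grp r = j), n r)) else 0 := by
  classical
  -- split both orbital sums along the fibres of `grp`
  rw [← Finset.sum_fiberwise Finset.univ grp]
  refine Finset.sum_congr rfl fun i _ => ?_
  have inner : ∀ p ∈ Finset.univ.filter (fun p => grp p = i),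
      (∑ r, (if grp r ≠ grp p then bx (grp p) (grp r) else 0) * (n p * n r)) =
        ∑ j, if i ≠ j then bx i j * (n p * ∑ r ∈ Finset.univ.filter (fun r => grp r = j), n r) else 0 := by
    intro p hp
    have hpi : grp p = i := (Finset.mem_filter.1 hp).2
    rw [← Finset.sum_fiberwise Finset.univ grp]
    refine Finset.sum_congr rfl fun j _ => ?_
    by_cases hij : i ≠ j
    · rw [if_pos hij, Finset.mul_sum, Finset.mul_sum]
      refine Finset.sum_congr rfl fun r hr => ?_
      have hrj : grp r = j := (Finset.mem_filter.1 hr).2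
      simp only [hpi, hrj, if_pos (Ne.symm hij)]
    · rw [if_neg hij]
      refine Finset.sum_eq_zero fun r hr => ?_
      have hrj : grp r = j := (Finset.mem_filter.1 hr).2
      simp only [hpi, hrj, if_neg (fun h => hij (Ne.symm h)), zero_mul]
  rw [Finset.sum_congr rfl inner, Finset.sum_comm]
  refine Finset.sum_congr rfl fun j _ => ?_
  by_cases hij : i ≠ j
  · simp only [if_pos hij]
    rw [Finset.sum_mul, Finset.mul_sum]
  · simp only [if_neg hij, Finset.sum_const_zero]

/-- **The inter-group density–density Hamiltonian is diagonal.** The two-electron table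
`(pq|rs) = [q = p][s = r][grp r ≠ grp p]·b×(grp p, grp r)` (zero one-electron table and scalar) generates
`½ Σ_{r≁p} b×(grp p, grp r) e_pprr = ½ Σ_{i≠j} b×(i,j) N̂_i N̂_j` = the DIAGONAL matrix with value
`½ Σ_{i≠j} b×(i,j) l_i(s) l_j(s)`, `l_i(s)` the group-`i` occupation of `s` (`e_pprr = E_pp E_rr − δ_pr E_pr`,
eq. (2.2.16); `p ≠ r` across groups). [cite: HelgakerJorgensenOlsen2000, eq. (2.2.16)] -/
theorem molecularHamiltonian_crossDensity_eq_diagonal (grp : Λ' → X) (bx : X → X → ℂ) :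
    molecularHamiltonian (fun _ _ => (0 : ℂ))
        (fun p q r s => if q = p ∧ s = r ∧ grp r ≠ grp p then bx (grp p) (grp r) else 0) 0 =
      diagonal fun s : Finset (Orb Λ') => (1 / 2 : ℂ) * ∑ i, ∑ j,
        if i ≠ j then bx i j *
          ((((((upPart s).filter (fun p => grp p = i)).card +
              ((downPart s).filter (fun p => grp p = i)).card : ℕ) : ℂ)) *
            ((((upPart s).filter (fun p => grp p = j)).card +
              ((downPart s).filter (fun p => grp p = j)).card : ℕ) : ℂ)) else 0 := by
  classical
  -- collapse the `q` and `s` sums and rewrite `e_pprr = E_pp E_rr` across groups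
  have hsum : ∀ p : Λ', (∑ q, ∑ r, ∑ s,
      (if q = p ∧ s = r ∧ grp r ≠ grp p then bx (grp p) (grp r) else 0) •
        twoElectronExcitation p q r s) =
      ∑ r, (if grp r ≠ grp p then bx (grp p) (grp r) else 0) •
        (singletExcitation p p * singletExcitation r r) := by
    intro p
    rw [Finset.sum_comm]
    refine Finset.sum_congr rfl fun r _ => ?_
    rw [Finset.sum_eq_single p, Finset.sum_eq_single r]
    · by_cases hpr : grp r ≠ grp p
      · have hne : p ≠ r := fun h => hpr (by rw [h])
        rw [if_pos ⟨rfl, rfl, hpr⟩, if_pos hpr, twoElectronExcitation_eq_mul_sub, if_neg hne, sub_zero]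
      · rw [if_neg (fun h => hpr h.2.2), if_neg hpr, zero_smul, zero_smul]
    · exact fun s _ hs => by rw [if_neg (fun h => hs h.2.1), zero_smul]
    · exact fun h => absurd (Finset.mem_univ _) h
    · exact fun q _ hq => Finset.sum_eq_zero fun s _ => by rw [if_neg (fun h => hq h.1), zero_smul]
    · exact fun h => absurd (Finset.mem_univ _) h
  unfold molecularHamiltonian
  simp only [zero_smul, Finset.sum_const_zero, zero_add, add_zero, hsum,
    singletExcitation_self_eq_diagonal, diagonal_mul_diagonal]
  ext s t  -- both sides are diagonal: compare the entries
  simp only [Matrix.smul_apply, Matrix.sum_apply, diagonal_apply, smul_eq_mul, mul_ite, mul_zero]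
  by_cases hst : s = t
  · subst hst
    simp only [if_true]
    congr 1
    rw [sum_sum_cross_eq_sum_sum_groups grp bx (fun p : Λ' =>
      ((((if p ∈ upPart s then (1 : ℝ) else 0) + (if p ∈ downPart s then (1 : ℝ) else 0) : ℝ)) : ℂ))]
    refine Finset.sum_congr rfl fun i _ => Finset.sum_congr rfl fun j _ => ?_
    rw [sum_filter_orbital_occupation, sum_filter_orbital_occupation]
  · simp only [hst, if_false, Finset.sum_const_zero, mul_zero]

/-- **On a joint occupation class the inter-group density–density Hamiltonian is a scalar.** If `z` is
supported on configurations with group occupations `l = (l_i)_i`, then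
`Ĥ× z = (½ Σ_{i≠j} b×(i,j) l_i l_j)·z`. [cite: HelgakerJorgensenOlsen2000, eq. (2.2.16)] -/
theorem crossDensity_mulVec_of_occupation (grp : Λ' → X) (bx : X → X → ℂ) (l : X → ℕ)
    (z : Fock (Orb Λ'))
    (hz : ∀ s, (fun i => ((upPart s).filter (fun p => grp p = i)).card +
      ((downPart s).filter (fun p => grp p = i)).card) ≠ l → z s = 0) :
    molecularHamiltonian (fun _ _ => (0 : ℂ))
        (fun p q r s => if q = p ∧ s = r ∧ grp r ≠ grp p then bx (grp p) (grp r) else 0) 0 *ᵥ z =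
      ((1 / 2 : ℂ) * ∑ i, ∑ j, if i ≠ j then bx i j * ((l i : ℂ) * (l j : ℂ)) else 0) • z := by
  classical
  rw [molecularHamiltonian_crossDensity_eq_diagonal]
  funext s
  rw [mulVec_diagonal, Pi.smul_apply, smul_eq_mul]
  by_cases hs : z s = 0
  · rw [hs, mul_zero, mul_zero]
  · have hl : (fun i => ((upPart s).filter (fun p => grp p = i)).card +
        ((downPart s).filter (fun p => grp p = i)).card) = l := by
      by_contra hne
      exact hs (hz s hne)
    congr 3
    funext i
    refine Finset.sum_congr rfl fun j _ => ?_
    rw [← congrFun hl i, ← congrFun hl j]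

/-- `⟨z, z⟩` is real: `Re(c·⟨z,z⟩) = Re c · Re⟨z,z⟩` (bookkeeping). [folklore] -/
private theorem re_mul_star_dotProduct_self' {n : Type*} [Fintype n] (c : ℂ) (z : n → ℂ) :
    (c * (star z ⬝ᵥ z)).re = c.re * (star z ⬝ᵥ z).re := by
  have him : (star z ⬝ᵥ z).im = 0 := by
    rw [dotProduct, Complex.im_sum]
    refine Finset.sum_eq_zero fun j _ => ?_
    rw [Pi.star_apply, Complex.star_def, Complex.conj_mul', ← Complex.ofReal_pow, Complex.ofReal_im]
  rw [Complex.mul_re, him, mul_zero, sub_zero]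

variable (grp : Λ' → X) (m : X → ℕ) (φ : ∀ i, Fin (m i) ↪o Λ')

/-- **TENSOR-BLOCK SPECTRUM LEMMA WITH INTER-GROUP DENSITY TERMS.** Let the orbitals be partitioned
into groups (`grp`, enumerated by order embeddings `φ i : Fin (m i) ↪o Λ'`), let `h_pq ≠ 0 ⇒ q ~ p`, let
every non-zero two-electron entry be EITHER group-local (`q ~ p ∧ r ~ p ∧ s ~ p`) OR a diagonal
density pair (`q = p ∧ s = r`), and let the INTER-group diagonal density entries be group-pair
constants, `(pp|rr) = b×(grp p, grp r)` for `r ≁ p`. For every group `i` let `U_i(N)` bound the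
quadratic form of the group's OWN Hamiltonian `Ĥ(h|_i, g|_i, 0)` on the `(a, b)` sectors of the
group's own Fock space with `a + b = N` (the restricted tables carry the intra-group density entries
and do not see the inter-group ones). Then for every joint occupation class `l = (l_i)_i` and every
`z` supported on it,
`Re⟨z, Ĥ(h, g, c) z⟩ ≤ (Re c + Σ_i U_i(l_i) + Re(½ Σ_{i≠j} b×(i,j) l_i l_j))·‖z‖²`
(`groupLocal_form_le` for the local part; the inter-group density part is the scalar of
`crossDensity_mulVec_of_occupation`). [cite: VerstichelEtAl2010Subsystem, §2.3 eqs. (16)-(24)] -/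
theorem groupLocalCross_form_le (hφ : ∀ i j, grp (φ i j) = i)
    (hcov : ∀ i p, grp p = i → ∃ j, φ i j = p)
    (h : Λ' → Λ' → ℂ) (g : Λ' → Λ' → Λ' → Λ' → ℂ) (c : ℂ) (bx : X → X → ℂ)
    (hh : ∀ p q, h p q ≠ 0 → grp q = grp p)
    (hg : ∀ p q r s, g p q r s ≠ 0 →
      (grp q = grp p ∧ grp r = grp p ∧ grp s = grp p) ∨ (q = p ∧ s = r))
    (hx : ∀ p r, grp r ≠ grp p → g p p r r = bx (grp p) (grp r))
    (U : X → ℕ → ℝ)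
    (hU : ∀ i a b (χ : Fock (Orb (Fin (m i)))), IsInSector a b χ →
      (star χ ⬝ᵥ molecularHamiltonian (fun p q => h (φ i p) (φ i q))
          (fun p q r s => g (φ i p) (φ i q) (φ i r) (φ i s)) 0 *ᵥ χ).re ≤
        U i (a + b) * (star χ ⬝ᵥ χ).re)
    (l : X → ℕ) (z : Fock (Orb Λ'))
    (hz : ∀ s, (fun i => ((upPart s).filter (fun p => grp p = i)).card +
      ((downPart s).filter (fun p => grp p = i)).card) ≠ l → z s = 0) :
    (star z ⬝ᵥ molecularHamiltonian h g c *ᵥ z).re ≤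
      (c.re + ∑ i, U i (l i) +
        ((1 / 2 : ℂ) * ∑ i, ∑ j, if i ≠ j then bx i j * ((l i : ℂ) * (l j : ℂ)) else 0).re) *
        (star z ⬝ᵥ z).re := by
  classical
  -- the group-local part and the inter-group density part of the two-electron table
  let gl : Λ' → Λ' → Λ' → Λ' → ℂ := fun p q r s =>
    if grp q = grp p ∧ grp r = grp p ∧ grp s = grp p then g p q r s else 0
  let gx : Λ' → Λ' → Λ' → Λ' → ℂ := fun p q r s =>
    if q = p ∧ s = r ∧ grp r ≠ grp p then bx (grp p) (grp r) else 0
  have hsplit : g = fun p q r s => gl p q r s + gx p q r s := by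
    funext p q r s
    show g p q r s = (if grp q = grp p ∧ grp r = grp p ∧ grp s = grp p then g p q r s else 0) +
      (if q = p ∧ s = r ∧ grp r ≠ grp p then bx (grp p) (grp r) else 0)
    by_cases hloc : grp q = grp p ∧ grp r = grp p ∧ grp s = grp p
    · rw [if_pos hloc, if_neg (fun h => h.2.2 hloc.2.1), add_zero]
    · rw [if_neg hloc, zero_add]
      by_cases hcross : q = p ∧ s = r
      · obtain ⟨hq, hs⟩ := hcross
        have hne : grp r ≠ grp p := fun hr => hloc ⟨by rw [hq], hr, by rw [hs, hr]⟩
        rw [if_pos ⟨hq, hs, hne⟩, hq, hs]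
        exact hx p r hne
      · rw [if_neg (fun h => hcross ⟨h.1, h.2.1⟩)]
        by_contra hne
        exact (hg p q r s hne).elim hloc hcross
  have hgl : ∀ p q r s, gl p q r s ≠ 0 → grp q = grp p ∧ grp r = grp p ∧ grp s = grp p :=
    fun p q r s hne => by by_contra hloc; exact hne (if_neg hloc)
  -- the restricted tables of the local part are the restricted tables of `g` (`hφ`)
  have hUl : ∀ i a b (χ : Fock (Orb (Fin (m i)))), IsInSector a b χ →
      (star χ ⬝ᵥ molecularHamiltonian (fun p q => h (φ i p) (φ i q))
          (fun p q r s => gl (φ i p) (φ i q) (φ i r) (φ i s)) 0 *ᵥ χ).re ≤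
        U i (a + b) * (star χ ⬝ᵥ χ).re := by
    intro i a b χ hχ
    have hrestr : (fun p q r s => gl (φ i p) (φ i q) (φ i r) (φ i s)) =
        fun p q r s => g (φ i p) (φ i q) (φ i r) (φ i s) := by
      funext p q r s
      exact if_pos (by simp only [hφ, and_self])
    rw [hrestr]
    exact hU i a b χ hχ
  -- the local part is bounded by `groupLocal_form_le`, the density part is a scalar on the class
  have hloc := groupLocal_form_le grp m φ hφ hcov h gl c hh hgl U hUl l z hz
  have hdens : (star z ⬝ᵥ molecularHamiltonian (fun _ _ => (0 : ℂ)) gx 0 *ᵥ z).re =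
      ((1 / 2 : ℂ) * ∑ i, ∑ j, if i ≠ j then bx i j * ((l i : ℂ) * (l j : ℂ)) else 0).re *
        (star z ⬝ᵥ z).re := by
    rw [crossDensity_mulVec_of_occupation grp bx l z hz, dotProduct_smul, smul_eq_mul,
      re_mul_star_dotProduct_self']
  rw [hsplit, molecularHamiltonian_add_eri, add_mulVec, dotProduct_add, Complex.add_re, hdens]
  calc (star z ⬝ᵥ molecularHamiltonian h gl c *ᵥ z).re +
        ((1 / 2 : ℂ) * ∑ i, ∑ j, if i ≠ j then bx i j * ((l i : ℂ) * (l j : ℂ)) else 0).re *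
          (star z ⬝ᵥ z).re
      ≤ (c.re + ∑ i, U i (l i)) * (star z ⬝ᵥ z).re +
        ((1 / 2 : ℂ) * ∑ i, ∑ j, if i ≠ j then bx i j * ((l i : ℂ) * (l j : ℂ)) else 0).re *
          (star z ⬝ᵥ z).re := by gcongr
    _ = _ := by ring

end CrossDensity

/-! ### 2. Uniform density tables: the local top of a number-polynomial group is exact -/

section UniformDensity

variable {Λ' : Type*} [LinearOrder Λ'] [Fintype Λ']

/-- The particle-number operator `N̂ = Σ_p E_pp` is DIAGONAL on determinants with value `|s↑| + |s↓|`
(`E_pp` of eq. (2.2.7), summed over the orbitals). [cite: HelgakerJorgensenOlsen2000, eq. (2.2.7)] -/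
theorem totalNumber_eq_diagonal :
    (∑ p : Λ', singletExcitation p p) =
      diagonal fun s : Finset (Orb Λ') => (((upPart s).card + (downPart s).card : ℕ) : ℂ) := by
  classical
  have h := weightedNumber_eq_diagonal (Λ := Λ') (fun _ => (1 : ℝ))
  simp only [Complex.ofReal_one, one_smul, Finset.sum_const] at h
  rw [h]
  congr 1
  funext s
  push_cast
  ring

/-- **A UNIFORM DENSITY Hamiltonian is a number polynomial.** For `h_pq = α·[p = q]`,
`(pq|rs) = β·[q = p][s = r]` (every orbital pair, `p = r` included) and scalar `c`:
`Ĥ(h, g, c) = c + α N̂ + ½β(N̂² − N̂)` (`e_pprr = E_pp E_rr − δ_pr E_pr`, eq. (2.2.16)) = the DIAGONAL matrix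
with value `c + αN(s) + ½β(N(s)² − N(s))`, `N(s) = |s↑| + |s↓|`. [cite: HelgakerJorgensenOlsen2000, eq. (2.2.16)] -/
theorem uniformDensity_hamiltonian_eq_diagonal (α β c : ℂ) :
    molecularHamiltonian (fun p q : Λ' => if p = q then α else 0)
        (fun p q r s : Λ' => if q = p ∧ s = r then β else 0) c =
      diagonal fun s : Finset (Orb Λ') =>
        c + α * (((upPart s).card + (downPart s).card : ℕ) : ℂ) +
          (1 / 2 : ℂ) * β * ((((upPart s).card + (downPart s).card : ℕ) : ℂ) ^ 2 -
            (((upPart s).card + (downPart s).card : ℕ) : ℂ)) := by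
  classical
  -- one-electron part: `Σ_pq α[p = q] E_pq = α N̂`
  have h1 : (∑ p : Λ', ∑ q : Λ', (if p = q then α else 0) • singletExcitation p q) =
      α • ∑ p : Λ', singletExcitation p p := by
    rw [Finset.smul_sum]
    refine Finset.sum_congr rfl fun p _ => ?_
    simp only [ite_smul, zero_smul, Finset.sum_ite_eq, Finset.mem_univ, if_true]
  -- two-electron part: `Σ_pqrs β[q = p][s = r] e_pqrs = β (N̂ N̂ − N̂)`
  have hone : ∀ p r : Λ', (∑ q, ∑ s, (if q = p ∧ s = r then β else 0) • twoElectronExcitation p q r s) =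
      β • (singletExcitation p p * singletExcitation r r) -
        (if p = r then β • singletExcitation p r else 0) := by
    intro p r
    rw [Finset.sum_eq_single p, Finset.sum_eq_single r]
    · rw [if_pos ⟨rfl, rfl⟩, twoElectronExcitation_eq_mul_sub, smul_sub]
      by_cases hpr : p = r
      · rw [if_pos hpr, if_pos hpr]
      · rw [if_neg hpr, if_neg hpr, smul_zero]
    · exact fun s _ hs => by rw [if_neg (fun h => hs h.2), zero_smul]
    · exact fun h => absurd (Finset.mem_univ _) h
    · exact fun q _ hq => Finset.sum_eq_zero fun s _ => by rw [if_neg (fun h => hq h.1), zero_smul]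
    · exact fun h => absurd (Finset.mem_univ _) h
  have h2 : (∑ p : Λ', ∑ q : Λ', ∑ r : Λ', ∑ s : Λ',
      (if q = p ∧ s = r then β else 0) • twoElectronExcitation p q r s) =
      β • ((∑ p : Λ', singletExcitation p p) * (∑ p : Λ', singletExcitation p p)) -
        β • ∑ p : Λ', singletExcitation p p := by
    have hp : ∀ p : Λ', (∑ q, ∑ r, ∑ s, (if q = p ∧ s = r then β else 0) • twoElectronExcitation p q r s) =
        ∑ r, (β • (singletExcitation p p * singletExcitation r r) -
          (if p = r then β • singletExcitation p r else 0)) := by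
      intro p
      rw [Finset.sum_comm]
      exact Finset.sum_congr rfl fun r _ => hone p r
    simp only [hp, Finset.sum_sub_distrib, Finset.sum_ite_eq, Finset.mem_univ, if_true,
      ← Finset.smul_sum, Finset.sum_mul_sum]
  unfold molecularHamiltonian
  rw [h1, h2, totalNumber_eq_diagonal, diagonal_mul_diagonal]
  ext s t
  simp only [Matrix.add_apply, Matrix.sub_apply, Matrix.smul_apply, diagonal_apply, Matrix.one_apply,
    smul_eq_mul, mul_ite, mul_one, mul_zero]
  by_cases hst : s = t
  · subst hst
    simp only [if_true]
    ring
  · simp only [hst, if_false, add_zero, sub_zero, mul_zero]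

/-- **On an `(a, b)` sector the uniform density Hamiltonian is the scalar `c + αN + ½β(N² − N)`,
`N = a + b`** — the local top of a group whose own tables are a uniform number polynomial is EXACT (kernel
discharge of `hU` of `groupLocal(Cross)_form_le` for such a group). [cite: HelgakerJorgensenOlsen2000, eq. (2.2.16)] -/
theorem uniformDensity_mulVec_of_sector (α β c : ℂ) {a b : ℕ} {χ : Fock (Orb Λ')}
    (hχ : IsInSector a b χ) :
    molecularHamiltonian (fun p q : Λ' => if p = q then α else 0)
        (fun p q r s : Λ' => if q = p ∧ s = r then β else 0) c *ᵥ χ =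
      (c + α * ((a + b : ℕ) : ℂ) + (1 / 2 : ℂ) * β * (((a + b : ℕ) : ℂ) ^ 2 - ((a + b : ℕ) : ℂ))) • χ := by
  classical
  rw [uniformDensity_hamiltonian_eq_diagonal]
  funext s
  rw [mulVec_diagonal, Pi.smul_apply, smul_eq_mul]
  by_cases hs : χ s = 0
  · rw [hs, mul_zero, mul_zero]
  · have hab : (upPart s).card = a ∧ (downPart s).card = b := by
      by_contra hne
      exact hs (hχ s hne)
    rw [hab.1, hab.2]

/-- Form version: on an `(a, b)` sector vector, `Re⟨χ, Ĥ(α, β, c)χ⟩ = Re(c + αN + ½β(N² − N))·‖χ‖²`,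
`N = a + b` (the exact local top of a uniform density group). [cite: HelgakerJorgensenOlsen2000, eq. (2.2.16)] -/
theorem uniformDensity_form_eq (α β c : ℂ) {a b : ℕ} {χ : Fock (Orb Λ')} (hχ : IsInSector a b χ) :
    (star χ ⬝ᵥ molecularHamiltonian (fun p q : Λ' => if p = q then α else 0)
        (fun p q r s : Λ' => if q = p ∧ s = r then β else 0) c *ᵥ χ).re =
      (c + α * ((a + b : ℕ) : ℂ) + (1 / 2 : ℂ) * β * (((a + b : ℕ) : ℂ) ^ 2 - ((a + b : ℕ) : ℂ))).re *
        (star χ ⬝ᵥ χ).re := by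
  rw [uniformDensity_mulVec_of_sector α β c hχ, dotProduct_smul, smul_eq_mul,
    re_mul_star_dotProduct_self']

end UniformDensity

end Literature.MathematicalPhysics.QuantumChemistry

end
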